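import Mathlib
import HarnessLib
import Summits.RiemannHypothesis.RiemannHypothesis.Theses.RuelleBand

/-!
# RiemannHypothesis / RuelleBand — `RealisationToAsymptotic` and `BandEngine`

Items stmt-RiemannHypothesis-2066 (`RealisationToAsymptotic`, closed by this file) and
stmt-RiemannHypothesis-2065 (`BandEngine`, proved here as `bandEngine_proof`).

Route `RiemannHypothesis/RuelleBand`, support item `RealisationToAsymptotic : BandRealisation →
AsymptoticCriticalLine`: if a one-parameter group `T` of bounded operators on a complex Hilbert space
is unitary modulo a compact operator at some time `t₀ > 0` and carries every non-trivial zero `ρ` of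
`ζ` as a joint eigenvalue with character `t ↦ exp (t (ρ - 1/2))`, then for every `ε > 0` only
finitely many zeros of the open critical strip satisfy `ε ≤ |Re ρ - 1/2|`.

## Proof (direct Hilbert-space argument; no analytic Fredholm theorem is needed)

* `tendsto_zero_of_orthonormal_of_isCompactOperator` : a compact operator sends an orthonormal
  sequence to a norm-null sequence (Bessel's inequality gives weak convergence to `0`; relative
  compactness of the image of the unit ball upgrades it along subsequences).
* `not_linearIndependent_eigenvectors_of_norm_ge` : if `A = U + K` with `U` norm-preserving and
  `K` compact, there is no linearly independent sequence of eigenvectors `A vₙ = μₙ vₙ` with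
  `‖μₙ‖ ≥ r > 1`.  Gram–Schmidt the `vₙ` into an orthonormal `wₙ`; since `A` maps
  `span {v₀,…,vₙ₋₁}` into itself and `wₙ ⊥` that span, `⟪wₙ, A wₙ⟫ = μₙ`, whence
  `r ≤ ‖μₙ‖ ≤ ‖A wₙ‖ ≤ ‖U wₙ‖ + ‖K wₙ‖ = 1 + ‖K wₙ‖ → 1`, a contradiction.
* `exists_time_exp_injective`, `linearIndependent_of_joint_eigenvectors` : joint eigenvectors with
  pairwise distinct characters `t ↦ exp (t zₙ)` are linearly independent (at a generic time `t` the
  numbers `exp (t zₙ)` are pairwise distinct — the bad times form a countable set — and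
  `Module.End.eigenvectors_linearIndependent'` applies to `T t`).
* `finite_jointEigenvalues_re_ge` : hence the joint eigenvalues `z` with `ε ≤ Re z` form a finite set
  whenever `T t₀ - U` is compact for some norm-preserving `U` and `t₀ > 0` (no group law needed).
* `isCompactOperator_rev_sub_star`, `finite_jointEigenvalues_abs_re_ge` : the half `Re z ≤ -ε`
  is the same statement for the reversed group `t ↦ T (-t)`, for which
  `T (-t₀) - U⋆ = T (-t₀) (U - T t₀) U⋆` is again compact (here the group law and unitarity
  enter); together: finitely many joint eigenvalues with `ε ≤ |Re z|`.
* `bandEngine_proof` : this is literally the route's support item `BandEngine`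
  (stmt-RiemannHypothesis-2065), so it is recorded as a theorem as well.
* `realisationToAsymptotic_proof` : `ρ ↦ ρ - 1/2` injects the exceptional zeros into that finite set.

Everything is Mathlib-only (Gram–Schmidt, Bessel, `IsCompactOperator`, `unitary`); the argument is
the Hilbert-space core of the Faure–Tsujii "unitary modulo compact on the first band ⇒ finitely many
resonances outside every strip" mechanism. Not here: the analytic Fredholm alternative / finer
spectral information (finite multiplicities are implicit in the proof but not stated).
-/

namespace Summit.RiemannHypothesis.RiemannHypothesis.Theorems

open Filter Topology InnerProductSpace Submodule
open scoped ComplexConjugate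

section Engine

variable {H : Type*} [NormedAddCommGroup H] [InnerProductSpace ℂ H]

local notation "⟪" x ", " y "⟫" => @inner ℂ _ _ x y

/-- A compact operator on a Hilbert space maps an orthonormal sequence to a sequence tending to `0`
in norm (Bessel: `K wₙ ⇀ 0` weakly; compactness of `K (unit ball)` upgrades this along every
subsequence). [folklore] -/
theorem tendsto_zero_of_orthonormal_of_isCompactOperator [CompleteSpace H] {w : ℕ → H}
    (hw : Orthonormal ℂ w) {K : H →L[ℂ] H} (hK : IsCompactOperator K) :
    Tendsto (fun n => K (w n)) atTop (𝓝 0) := by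
  -- weak convergence to `0`
  have hweak : ∀ a : H, Tendsto (fun n => ⟪K (w n), a⟫) atTop (𝓝 0) := by
    intro a
    have hs : Summable fun n => ‖⟪w n, (ContinuousLinearMap.adjoint K) a⟫‖ ^ 2 :=
      hw.inner_products_summable _
    have h1 : Tendsto (fun n => ‖⟪w n, (ContinuousLinearMap.adjoint K) a⟫‖ ^ 2) atTop (𝓝 0) :=
      hs.tendsto_atTop_zero
    have h2 : Tendsto (fun n => Real.sqrt (‖⟪w n, (ContinuousLinearMap.adjoint K) a⟫‖ ^ 2))
        atTop (𝓝 (Real.sqrt 0)) := h1.sqrt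
    simp only [Real.sqrt_sq (norm_nonneg _), Real.sqrt_zero,
      ContinuousLinearMap.adjoint_inner_right] at h2
    exact tendsto_zero_iff_norm_tendsto_zero.mpr h2
  obtain ⟨S, hS, hKS⟩ := hK.image_closedBall_subset_compact 1
  have hmem : ∀ n, K (w n) ∈ S := fun n =>
    hKS ⟨w n, by simp [Metric.mem_closedBall, hw.1 n], rfl⟩
  refine tendsto_of_subseq_tendsto fun ns hns => ?_
  obtain ⟨a, -, ms, hms, hlim⟩ :=
    hS.tendsto_subseq (x := fun n => K (w (ns n))) fun n => hmem (ns n)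
  have hA : Tendsto (fun n => ⟪K (w (ns (ms n))), a⟫) atTop (𝓝 ⟪a, a⟫) :=
    hlim.inner tendsto_const_nhds
  have hB : Tendsto (fun n => ⟪K (w (ns (ms n))), a⟫) atTop (𝓝 0) :=
    (hweak a).comp (hns.comp hms.tendsto_atTop)
  have ha : a = 0 := inner_self_eq_zero.mp (tendsto_nhds_unique hA hB)
  refine ⟨ms, ?_⟩
  rw [ha] at hlim
  exact hlim

/-- **Core estimate.** If `A - U` is compact with `U` norm-preserving, then `A` admits no linearly
independent sequence of eigenvectors whose eigenvalues all have modulus `≥ r` for some `r > 1`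
(Gram–Schmidt: the orthonormalised `wₙ` satisfy `⟪wₙ, A wₙ⟫ = μₙ`, so
`r ≤ ‖A wₙ‖ ≤ 1 + ‖(A - U) wₙ‖ → 1`). [folklore] -/
theorem not_linearIndependent_eigenvectors_of_norm_ge [CompleteSpace H] (A U : H →L[ℂ] H)
    (hU : ∀ x, ‖U x‖ = ‖x‖) (hK : IsCompactOperator (A - U)) {r : ℝ} (hr : 1 < r)
    (v : ℕ → H) (μ : ℕ → ℂ) (hv : ∀ n, A (v n) = μ n • v n) (hμ : ∀ n, r ≤ ‖μ n‖)
    (hlin : LinearIndependent ℂ v) : False := by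
  set g : ℕ → H := gramSchmidt ℂ v with hg_def
  set w : ℕ → H := gramSchmidtNormed ℂ v with hw_def
  have hw : Orthonormal ℂ w := gramSchmidtNormed_orthonormal hlin
  -- Step 1: `⟪w n, A (w n)⟫ = μ n`.
  have hinner : ∀ n, ⟪w n, A (w n)⟫ = μ n := by
    intro n
    set S : Submodule ℂ H := span ℂ (v '' Set.Iio n) with hS_def
    -- `A` maps `S` into itself
    have hAS : ∀ x ∈ S, A x ∈ S := by
      intro x hx
      refine Submodule.span_induction (p := fun x _ => A x ∈ S) ?_ ?_ ?_ ?_ hx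
      · rintro _ ⟨i, hi, rfl⟩
        rw [hv i]
        exact S.smul_mem _ (subset_span ⟨i, hi, rfl⟩)
      · simp
      · intro x y _ _ hx hy
        rw [map_add]
        exact S.add_mem hx hy
      · intro c x _ hx
        rw [map_smul]
        exact S.smul_mem c hx
    -- `g n = a • v n + s` with `s ∈ S`
    have hgn : g n ∈ span ℂ (v '' Set.Iic n) := gramSchmidt_mem_span ℂ v le_rfl
    rw [← Set.Iio_insert, Set.image_insert_eq, mem_span_insert] at hgn
    obtain ⟨a, s, hs, hgs⟩ := hgn
    have hdiff : A (g n) - μ n • g n ∈ S := by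
      have h1 : A (g n) - μ n • g n = A s - μ n • s := by
        rw [hgs, map_add, map_smul, hv n, smul_add, smul_comm a (μ n) (v n)]
        abel
      rw [h1]
      exact S.sub_mem (hAS s hs) (S.smul_mem _ hs)
    -- `g n ⊥ S`
    have horth : ∀ x ∈ S, ⟪g n, x⟫ = 0 := by
      intro x hx
      rw [hS_def, ← span_gramSchmidt_Iio ℂ v n] at hx
      refine Submodule.span_induction (p := fun x _ => ⟪g n, x⟫ = 0) ?_ ?_ ?_ ?_ hx
      · rintro _ ⟨i, hi, rfl⟩
        exact gramSchmidt_orthogonal ℂ v (Set.mem_Iio.mp hi).ne'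
      · exact inner_zero_right _
      · intro x y _ _ hx hy
        rw [inner_add_right, hx, hy, add_zero]
      · intro c x _ hx
        rw [inner_smul_right, hx, mul_zero]
    -- transfer to `w n = ‖g n‖⁻¹ • g n`
    have hwn : w n = ((‖g n‖ : ℂ))⁻¹ • g n := rfl
    have hdiff' : A (w n) - μ n • w n ∈ S := by
      rw [hwn, map_smul, smul_comm (μ n) ((‖g n‖ : ℂ))⁻¹ (g n), ← smul_sub]
      exact S.smul_mem _ hdiff
    have horth' : ∀ x ∈ S, ⟪w n, x⟫ = 0 := fun x hx => by
      rw [hwn, inner_smul_left, horth x hx, mul_zero]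
    have hww : ⟪w n, w n⟫ = 1 := by
      classical
      have := orthonormal_iff_ite.mp hw n n
      simpa using this
    calc ⟪w n, A (w n)⟫ = ⟪w n, μ n • w n + (A (w n) - μ n • w n)⟫ := by
          congr 1; abel
      _ = μ n := by
          rw [inner_add_right, inner_smul_right, horth' _ hdiff', hww]; ring
  -- Step 2: `r ≤ ‖μ n‖ ≤ ‖A (w n)‖ ≤ 1 + ‖(A - U) (w n)‖`.
  have hbound : ∀ n, r ≤ 1 + ‖(A - U) (w n)‖ := by
    intro n
    have h1 : ‖μ n‖ ≤ ‖A (w n)‖ := by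
      calc ‖μ n‖ = ‖⟪w n, A (w n)⟫‖ := by rw [hinner]
        _ ≤ ‖w n‖ * ‖A (w n)‖ := norm_inner_le_norm _ _
        _ = ‖A (w n)‖ := by rw [hw.1 n, one_mul]
    have h2 : ‖A (w n)‖ ≤ 1 + ‖(A - U) (w n)‖ := by
      have h3 : A (w n) = U (w n) + (A - U) (w n) := by simp
      calc ‖A (w n)‖ = ‖U (w n) + (A - U) (w n)‖ := by rw [← h3]
        _ ≤ ‖U (w n)‖ + ‖(A - U) (w n)‖ := norm_add_le _ _
        _ = 1 + ‖(A - U) (w n)‖ := by rw [hU, hw.1 n]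
    linarith [hμ n]
  -- Step 3: `‖(A - U) (w n)‖ → 0`, contradiction.
  have hlim : Tendsto (fun n => ‖(A - U) (w n)‖) atTop (𝓝 0) :=
    tendsto_zero_iff_norm_tendsto_zero.mp
      (tendsto_zero_of_orthonormal_of_isCompactOperator hw hK)
  have hlim' : Tendsto (fun n => 1 + ‖(A - U) (w n)‖) atTop (𝓝 (1 + 0)) :=
    tendsto_const_nhds.add hlim
  have : r ≤ 1 + 0 := ge_of_tendsto hlim' (Eventually.of_forall hbound)
  linarith

/-- For countably many pairwise distinct complex numbers `z n` there is a real time `t` at which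
the characters `exp (t * z n)` are still pairwise distinct: the bad times form a countable set.
[folklore] -/
theorem exists_time_exp_injective (z : ℕ → ℂ) (hz : Function.Injective z) :
    ∃ t : ℝ, Function.Injective fun n => Complex.exp (t * z n) := by
  let B : Set ℝ :=
    ⋃ i : ℕ, ⋃ j : ℕ, {t : ℝ | i ≠ j ∧ Complex.exp (t * z i) = Complex.exp (t * z j)}
  have hB : B.Countable := by
    refine Set.countable_iUnion fun i => Set.countable_iUnion fun j => ?_
    by_cases hij : i = j
    · have : {t : ℝ | i ≠ j ∧ Complex.exp (t * z i) = Complex.exp (t * z j)} = ∅ := by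
        ext t; simp [hij]
      rw [this]
      exact Set.countable_empty
    · have hsub : {t : ℝ | i ≠ j ∧ Complex.exp (t * z i) = Complex.exp (t * z j)} ⊆
          ⋃ k : ℤ, {t : ℝ | (t : ℂ) * z i = t * z j + k * (2 * Real.pi * Complex.I)} := by
        rintro t ⟨-, ht⟩
        obtain ⟨k, hk⟩ := Complex.exp_eq_exp_iff_exists_int.mp ht
        exact Set.mem_iUnion.mpr ⟨k, hk⟩
      refine Set.Countable.mono hsub (Set.countable_iUnion fun k => ?_)
      refine Set.Subsingleton.countable ?_
      intro t ht t' ht'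
      simp only [Set.mem_setOf_eq] at ht ht'
      have hzij : z i - z j ≠ 0 := sub_ne_zero.mpr fun h => hij (hz h)
      have hmul : ((t : ℂ) - t') * (z i - z j) = 0 := by linear_combination ht - ht'
      rcases mul_eq_zero.mp hmul with h | h
      · exact_mod_cast sub_eq_zero.mp h
      · exact absurd h hzij
  obtain ⟨t, ht⟩ : ∃ t, t ∉ B := by
    by_contra h
    push Not at h
    exact Cardinal.not_countable_real (hB.mono fun t _ => h t)
  refine ⟨t, fun i j hij => ?_⟩
  by_contra hne
  exact ht (Set.mem_iUnion.mpr ⟨i, Set.mem_iUnion.mpr ⟨j, hne, hij⟩⟩)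

/-- Joint eigenvectors of a family of operators `T t` (`t : ℝ`) with pairwise distinct exponential
characters `t ↦ exp (t * z n)` are linearly independent (no group law or commutativity is needed:
at a generic time the eigenvalues `exp (t * z n)` of the single operator `T t` are distinct).
[folklore] -/
theorem linearIndependent_of_joint_eigenvectors (T : ℝ → H →L[ℂ] H) (z : ℕ → ℂ)
    (hz : Function.Injective z) (v : ℕ → H) (hv0 : ∀ n, v n ≠ 0)
    (hv : ∀ n t, T t (v n) = Complex.exp (t * z n) • v n) : LinearIndependent ℂ v := by
  obtain ⟨t, ht⟩ := exists_time_exp_injective z hz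
  refine Module.End.eigenvectors_linearIndependent' ((T t : H →L[ℂ] H) : Module.End ℂ H)
    (fun n => Complex.exp (t * z n)) ht v fun n => ⟨?_, hv0 n⟩
  rw [Module.End.mem_eigenspace_iff]
  exact hv n t

/-- **One-sided band engine.** If `T t₀ - U` is compact for some `t₀ > 0` and some norm-preserving
`U`, then for every `ε > 0` the joint eigenvalues `z` of the family `T` (`T t v = exp (t z) v` for
all `t`, some `v ≠ 0`) with `ε ≤ Re z` form a finite set. [folklore] -/
theorem finite_jointEigenvalues_re_ge [CompleteSpace H] (T : ℝ → H →L[ℂ] H) {t₀ : ℝ}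
    (ht₀ : 0 < t₀) (U : H →L[ℂ] H) (hU : ∀ x, ‖U x‖ = ‖x‖)
    (hK : IsCompactOperator (T t₀ - U)) {ε : ℝ} (hε : 0 < ε) :
    {z : ℂ | ε ≤ z.re ∧ ∃ v : H, v ≠ 0 ∧ ∀ t : ℝ, T t v = Complex.exp (t * z) • v}.Finite := by
  by_contra hinf
  set Z := {z : ℂ | ε ≤ z.re ∧ ∃ v : H, v ≠ 0 ∧ ∀ t : ℝ, T t v = Complex.exp (t * z) • v}
    with hZ_def
  let e := Set.Infinite.natEmbedding Z hinf
  set z : ℕ → ℂ := fun n => ((e n : Z) : ℂ) with hz_def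
  have hz : Function.Injective z := fun i j hij => e.injective (Subtype.ext hij)
  have hre : ∀ n, ε ≤ (z n).re := fun n => (e n).2.1
  have hex : ∀ n, ∃ v : H, v ≠ 0 ∧ ∀ t : ℝ, T t v = Complex.exp (t * z n) • v :=
    fun n => (e n).2.2
  choose v hv0 hv using hex
  have hlin : LinearIndependent ℂ v := linearIndependent_of_joint_eigenvectors T z hz v hv0 hv
  refine not_linearIndependent_eigenvectors_of_norm_ge (T t₀) U hU hK (r := Real.exp (t₀ * ε))
    ?_ v (fun n => Complex.exp (t₀ * z n)) (fun n => hv n t₀) ?_ hlin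
  · exact Real.one_lt_exp_iff.mpr (mul_pos ht₀ hε)
  · intro n
    rw [Complex.norm_exp, Complex.re_ofReal_mul]
    exact Real.exp_le_exp.mpr (mul_le_mul_of_nonneg_left (hre n) ht₀.le)

/-- **Time reversal.** For a one-parameter group `T` (`T 0 = id`, `T (s + t) = T s ∘ T t`) with
`T t₀ - U` compact and `U` unitary, the reversed group is again unitary modulo compact at `t₀`:
`T (-t₀) - U⋆ = T (-t₀) ∘ (U - T t₀) ∘ U⋆` is compact. [folklore] -/
theorem isCompactOperator_rev_sub_star [CompleteSpace H] (T : ℝ → H →L[ℂ] H)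
    (hT0 : T 0 = ContinuousLinearMap.id ℂ H) (hTadd : ∀ s t : ℝ, T (s + t) = (T s).comp (T t))
    {t₀ : ℝ} {U : H →L[ℂ] H} (hU : U ∈ unitary (H →L[ℂ] H))
    (hK : IsCompactOperator (T t₀ - U)) : IsCompactOperator (T (-t₀) - star U) := by
  have hid : T (-t₀) * T t₀ = 1 := by
    have h := hTadd (-t₀) t₀
    rw [neg_add_cancel, hT0] at h
    rw [ContinuousLinearMap.mul_def, ← h, ContinuousLinearMap.one_def]
  have heq : T (-t₀) - star U = T (-t₀) * (U - T t₀) * star U := by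
    rw [mul_sub, sub_mul, mul_assoc (T (-t₀)) U (star U), Unitary.mul_star_self_of_mem hU,
      mul_one, hid, one_mul]
  have hK' : IsCompactOperator (U - T t₀ : H →L[ℂ] H) := by
    have hfun : (⇑(U - T t₀ : H →L[ℂ] H)) = -⇑(T t₀ - U : H →L[ℂ] H) := by
      ext x; simp
    rw [hfun]
    exact hK.neg
  rw [heq]
  exact (hK'.comp_clm (star U)).clm_comp (T (-t₀))

/-- **The band engine (two-sided).** For a one-parameter group `T` of bounded operators on a
complex Hilbert space that is unitary modulo a compact operator at some time `t₀ > 0`, and every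
`ε > 0`, the joint eigenvalues `z` (`T t v = exp (t z) v` for all `t`, some `v ≠ 0`) with
`ε ≤ |Re z|` form a finite set: the half `ε ≤ Re z` is `finite_jointEigenvalues_re_ge`, the half
`Re z ≤ -ε` is the same statement for the reversed group `t ↦ T (-t)`. [folklore] -/
theorem finite_jointEigenvalues_abs_re_ge [CompleteSpace H] (T : ℝ → H →L[ℂ] H)
    (hT0 : T 0 = ContinuousLinearMap.id ℂ H) (hTadd : ∀ s t : ℝ, T (s + t) = (T s).comp (T t))
    {t₀ : ℝ} (ht₀ : 0 < t₀) {U : H →L[ℂ] H} (hU : U ∈ unitary (H →L[ℂ] H))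
    (hK : IsCompactOperator (T t₀ - U)) {ε : ℝ} (hε : 0 < ε) :
    {z : ℂ | ε ≤ |z.re| ∧ ∃ v : H, v ≠ 0 ∧ ∀ t : ℝ, T t v = Complex.exp (t * z) • v}.Finite := by
  have hUn : ∀ x, ‖U x‖ = ‖x‖ := fun x => ContinuousLinearMap.norm_map_of_mem_unitary hU x
  have hUs : ∀ x, ‖(star U) x‖ = ‖x‖ := fun x =>
    ContinuousLinearMap.norm_map_of_mem_unitary (Unitary.star_mem hU) x
  have hplus := finite_jointEigenvalues_re_ge T ht₀ U hUn hK hε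
  have hminus := finite_jointEigenvalues_re_ge (fun t => T (-t)) ht₀ (star U) hUs
    (isCompactOperator_rev_sub_star T hT0 hTadd hU hK) hε
  refine Set.Finite.subset (hplus.union (hminus.preimage neg_injective.injOn)) ?_
  rintro z ⟨hz, v, hv0, hv⟩
  rcases le_abs.mp hz with h | h
  · exact Or.inl ⟨h, v, hv0, hv⟩
  · right
    refine ⟨?_, v, hv0, fun t => ?_⟩
    · show ε ≤ (-z).re
      rw [Complex.neg_re]
      exact h
    · show T (-t) v = Complex.exp (↑t * -z) • v
      rw [hv (-t)]
      congr 1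
      push_cast
      ring_nf

end Engine

open Summit.RiemannHypothesis.RiemannHypothesis.Theses.RuelleBand

/-- **Item stmt-RiemannHypothesis-2065 (`BandEngine`), proved.** The abstract Faure–Tsujii / Weyl
engine as typed on the route: a one-parameter group on a complex Hilbert space, unitary modulo a
compact operator at some `t₀ > 0`, has only finitely many joint eigenvalues `z` with `ε ≤ |Re z|`,
for every `ε > 0`. Immediate from `finite_jointEigenvalues_abs_re_ge`. [folklore] -/
theorem bandEngine_proof : BandEngine := by
  unfold BandEngine
  intro H _ _ _ T hT0 hTadd hUK ε hε
  obtain ⟨t₀, ht₀, U, hU, hK⟩ := hUK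
  exact finite_jointEigenvalues_abs_re_ge T hT0 hTadd ht₀ hU hK hε

/-- **Item stmt-RiemannHypothesis-2066 (`RealisationToAsymptotic`).** A first-band realisation of
the non-trivial zeros (a one-parameter group on a complex Hilbert space, unitary modulo a compact
operator at some time `t₀ > 0`, with every non-trivial zero `ρ` a joint eigenvalue of character
`exp (t (ρ - 1/2))`) forces `AsymptoticCriticalLine`: for every `ε > 0` only finitely many zeros of
the open strip have `ε ≤ |Re ρ - 1/2|` — the map `ρ ↦ ρ - 1/2` injects them into the finite set of
joint eigenvalues `z` with `ε ≤ |Re z|` of the band engine. [folklore] -/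
theorem realisationToAsymptotic_proof : RealisationToAsymptotic := by
  unfold RealisationToAsymptotic BandRealisation AsymptoticCriticalLine
  rintro ⟨H, _, _, _, T, hT0, hTadd, ⟨t₀, ht₀, U, hU, hK⟩, heig⟩ ε hε
  have hfin := finite_jointEigenvalues_abs_re_ge T hT0 hTadd ht₀ hU hK hε
  refine Set.Finite.subset (hfin.preimage (sub_left_injective (b := (1 / 2 : ℂ))).injOn) ?_
  rintro s ⟨hζ, h0, h1, hεs⟩
  obtain ⟨v, hv0, hv⟩ := heig s hζ h0 h1
  refine ⟨?_, v, hv0, fun t => hv t⟩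
  have hre : (s - 1 / 2 : ℂ).re = s.re - 1 / 2 := by simp
  show ε ≤ |(s - 1 / 2 : ℂ).re|
  rw [hre]
  exact hεs

end Summit.RiemannHypothesis.RiemannHypothesis.Theorems
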